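import Summits.CriticalPhenomena.CardyFormulaZ2.Theorems.CardyComplexConeDefs
import Summits.CriticalPhenomena.CardyFormulaZ2.Theorems.CardyComplexConeCoherentMoreraTraceIdentityAux
import Summits.CriticalPhenomena.CardyFormulaZ2.Theorems.ParafermionPrecompact.Negative.ParafermionPrecompactFalseOfBulkNondegenerate

/-!
# Stub `stub_precompactTransfer` of line `finitary-green-pairing`
(crux `CoherentMorera`, stmt-CriticalPhenomena-11388)

**Precompact transfer.** The twin crux `EdgePrecompact` (precompactness of the spin-`1/3` CORNER
observable `E_δ`, class by class: local `O(δ^{1/3})` bound (i) and same-class equicontinuity (ii) on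
compacts) together with the trace identity in expectation on compacts
(`TraceIdentityOn D Λ`: eventually `2cos(π/12) · F_δ(s(x, x + eᵢ)) = Σ_{k<4} E_δ(cornersAt x i k)`)
give clause (ii) of the crux `CoherentMorera` at the family `Λ`, i.e. `VertexPrecompactAt D Λ`:
the VERTEX observable `F_δ` is `O(δ^{1/3})` and asymptotically equicontinuous at scale `δ^{1/3}` on
the genuine medial vertices (lattice edges) of every compact `K ⊂ D`.

Proof (the sibling skeleton's `parafermionPrecompactRepairedAt_of`, with the four-corner split now
the integrated hypothesis `TraceIdentityOn`).  Fix a compact `K ⊆ D` and an inner collar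
`K' = cthickening ρ K ⊆ D` (`ρ > 0`).  A lattice edge is `z = s(x, x + eᵢ)`; the sites of its four
corners `cornersAt x i k` are endpoints of `z`, at distance `δ/2` from the medial point `m_z`, hence
in `K'` once `m_z ∈ K` and `δ < ρ`.  Clause (i): `2cos(π/12) ‖F_δ(z)‖ ≤ Σ_k ‖E_δ(c_k)‖ ≤ 4Cδ^{1/3}`
by (i) of `EdgePrecompact` on `K'`.  Clause (ii): pair the corner `k` at `z` with the corner of the
SAME CLASS at `z'` (`exists_partner`: the identity for parallel edges, the half-turn `k ↦ k + 2`
otherwise); paired sites are within `dist(m_z, m_{z'}) + δ < η'` when `dist(m_z, m_{z'}) < η'/2` and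
`δ < η'/2`, so (ii) of `EdgePrecompact` on `K'` with `ε' = ε · 2cos(π/12) / 4` bounds each of the
four paired differences `E_δ(c_k) − E_δ(c'_{σ k})`, which sum to `2cos(π/12) (F_δ(z) − F_δ(z'))`.
-/

namespace Summit.CriticalPhenomena.CardyFormulaZ2.Cruxes.CoherentMorera.FinitaryGreenPairing

open MeasureTheory Filter Set Metric
open scoped Topology BigOperators
open Literature.Probability.LatticeModels
open Literature.Probability.RandomPlanarGeometry (DobrushinDomain)
open Summit.CriticalPhenomena.CardyFormulaZ2.Theses.CardyComplexCone (EdgePrecompact)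
open Summit.CriticalPhenomena.CardyFormulaZ2.Theorems.ParafermionPrecompact.Negative
  (exists_eq_mk_add_single)

noncomputable section

namespace PrecompactTransfer

/-! ## The four corners at a genuine medial vertex: corners, endpoints, classes -/

/-- Each entry of `cornersAt` is a corner. -/
theorem isCorner_cornersAt (x : Site 2) (i : Fin 2) (k : Fin 4) :
    IsCorner (cornersAt x i k).1 (cornersAt x i k).2 := by
  fin_cases i <;> fin_cases k <;> intro j <;> fin_cases j <;> simp [cornersAt]

/-- The site of each of the four corners at `s(x, x + eᵢ)` is an endpoint of that edge. -/
theorem fst_cornersAt_mem (x : Site 2) (i : Fin 2) (k : Fin 4) :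
    (cornersAt x i k).1 ∈ (s(x, x + Pi.single i 1) : MedialVertex) := by
  fin_cases i <;> fin_cases k <;> simp [cornersAt]

/-- **Four-class incidence.** The corners at a medial vertex of direction `i` and those at a
medial vertex of direction `i'` are paired class by class (`f − v` preserved) by a permutation of
`Fin 4`: the identity if `i = i'`, the half-turn `k ↦ k + 2` otherwise (the clockwise class lists
are `0, −e₀, −e₀−e₁, −e₁` at a horizontal and `−e₀−e₁, −e₁, 0, −e₀` at a vertical medial vertex). -/
theorem exists_partner (i i' : Fin 2) :
    ∃ σ : Equiv.Perm (Fin 4), ∀ (x x' : Site 2) (k : Fin 4),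
      (cornersAt x i k).2 - (cornersAt x i k).1 =
        (cornersAt x' i' (σ k)).2 - (cornersAt x' i' (σ k)).1 := by
  refine ⟨if i = i' then Equiv.refl _ else Equiv.addRight 2, fun x x' k => ?_⟩
  fin_cases i <;> fin_cases i' <;> fin_cases k <;> simp [cornersAt] <;> abel

/-! ## Constants and distances -/

/-- `2 cos(π/12) > 0`. -/
theorem splitConst_pos : 0 < 2 * Real.cos (Real.pi / 12) := by
  have h : 0 < Real.cos (Real.pi / 12) := by
    apply Real.cos_pos_of_mem_Ioo
    constructor <;> linarith [Real.pi_pos]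
  linarith

/-- The site of every corner at `s(x, x + eᵢ)` is within `δ/2` of the medial point (`δ ≥ 0`). -/
theorem dist_fst_cornersAt_medialPoint {δ : ℝ} (hδ : 0 ≤ δ) (x : Site 2) (i : Fin 2)
    (k : Fin 4) :
    dist (meshPoint δ (cornersAt x i k).1) (medialPoint δ s(x, x + Pi.single i 1)) = δ / 2 :=
  TraceIdentity.dist_meshPoint_medialPoint hδ (fst_cornersAt_mem x i k)

/-- **Inner collar.** If the medial point of `s(x, x + eᵢ)` lies in `K` and `0 ≤ δ ≤ ρ`, the sites
of its four corners lie in the closed `ρ`-thickening of `K`. -/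
theorem meshPoint_fst_cornersAt_mem_cthickening {δ ρ : ℝ} (hδ : 0 ≤ δ) (hδρ : δ ≤ ρ)
    {K : Set ℂ} (x : Site 2) (i : Fin 2) (k : Fin 4)
    (hzK : medialPoint δ s(x, x + Pi.single i 1) ∈ K) :
    meshPoint δ (cornersAt x i k).1 ∈ cthickening ρ K := by
  refine mem_cthickening_of_dist_le _ _ ρ K hzK ?_
  rw [dist_fst_cornersAt_medialPoint hδ]
  linarith

/-- Paired corner sites of two edges are within `dist` of the medial points `+ δ`. -/
theorem dist_fst_cornersAt_le {δ : ℝ} (hδ : 0 ≤ δ) (x x' : Site 2) (i i' : Fin 2)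
    (k k' : Fin 4) :
    dist (meshPoint δ (cornersAt x i k).1) (meshPoint δ (cornersAt x' i' k').1) ≤
      dist (medialPoint δ s(x, x + Pi.single i 1)) (medialPoint δ s(x', x' + Pi.single i' 1))
        + δ :=
  calc dist (meshPoint δ (cornersAt x i k).1) (meshPoint δ (cornersAt x' i' k').1)
      ≤ dist (meshPoint δ (cornersAt x i k).1) (medialPoint δ s(x, x + Pi.single i 1)) +
          dist (medialPoint δ s(x, x + Pi.single i 1)) (medialPoint δ s(x', x' + Pi.single i' 1)) +
          dist (medialPoint δ s(x', x' + Pi.single i' 1)) (meshPoint δ (cornersAt x' i' k').1) :=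
        dist_triangle4 _ _ _ _
    _ = dist (medialPoint δ s(x, x + Pi.single i 1)) (medialPoint δ s(x', x' + Pi.single i' 1))
          + δ := by
        rw [dist_fst_cornersAt_medialPoint hδ, dist_comm (medialPoint δ _) (meshPoint δ _),
          dist_fst_cornersAt_medialPoint hδ]
        ring

/-! ## The twin crux read over `cornerObs` -/

/-- **Bridge (definitional): `EdgePrecompact` read over `cornerObs`** (`cornerObs Λ δ (v, f)` is by
`rfl` the `let E` of the route declaration). -/
theorem edgePrecompact_cornerObs (hEP : EdgePrecompact) (D : DobrushinDomain)
    (Λ : ℝ → DiscreteDobrushin) (hΩ : ∀ δ, (Λ δ).Ω = D.carrier) (hδ : ∀ δ, (Λ δ).δ = δ)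
    (hadm : ∀ᶠ δ in 𝓝[>] (0:ℝ), (Λ δ).IsZdAdmissible) (K : Set ℂ) (hK : IsCompact K)
    (hKD : K ⊆ D.carrier) :
    (∃ C : ℝ, ∀ᶠ δ in 𝓝[>] (0:ℝ), ∀ v f : Site 2, IsCorner v f → meshPoint δ v ∈ K →
        ‖cornerObs Λ δ (v, f)‖ ≤ C * δ ^ ((1:ℝ) / 3)) ∧
      (∀ ε > (0:ℝ), ∃ η > (0:ℝ), ∀ᶠ δ in 𝓝[>] (0:ℝ), ∀ v f v' f' : Site 2,
        IsCorner v f → IsCorner v' f' → f - v = f' - v' → meshPoint δ v ∈ K →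
          meshPoint δ v' ∈ K → dist (meshPoint δ v) (meshPoint δ v') < η →
            ‖cornerObs Λ δ (v, f) - cornerObs Λ δ (v', f')‖ ≤ ε * δ ^ ((1:ℝ) / 3)) :=
  hEP D Λ hΩ hδ hadm K hK hKD

/-! ## The two clauses at one mesh (deterministic cores) -/

/-- **Clause (i) at one mesh.** If `2cos(π/12) · V = Σ_k b k` and `‖b k‖ ≤ B` for all `k`, then
`‖V‖ ≤ 4 B / (2cos(π/12))`. -/
theorem norm_le_of_trace {V : ℂ} {b : Fin 4 → ℂ} {B : ℝ}
    (hid : ((2 * Real.cos (Real.pi / 12) : ℝ) : ℂ) * V = ∑ k, b k) (hb : ∀ k, ‖b k‖ ≤ B) :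
    ‖V‖ ≤ 4 * B / (2 * Real.cos (Real.pi / 12)) := by
  have hκ : 0 < 2 * Real.cos (Real.pi / 12) := splitConst_pos
  have h1 : (2 * Real.cos (Real.pi / 12)) * ‖V‖ = ‖∑ k, b k‖ := by
    rw [← hid, norm_mul, Complex.norm_real, Real.norm_eq_abs, abs_of_pos hκ]
  have h2 : ‖∑ k, b k‖ ≤ 4 * B :=
    calc ‖∑ k, b k‖ ≤ ∑ k, ‖b k‖ := norm_sum_le _ _
      _ ≤ ∑ _k : Fin 4, B := Finset.sum_le_sum fun k _ => hb k
      _ = 4 * B := by simp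
  rw [le_div_iff₀ hκ, mul_comm, h1]
  exact h2

/-- **Clause (ii) at one mesh.** If `2cos(π/12) · V = Σ_k b k`, `2cos(π/12) · V' = Σ_k b' k` and the
differences paired along a permutation `σ` obey `‖b k − b' (σ k)‖ ≤ ε · 2cos(π/12) / 4`, then
`‖V − V'‖ ≤ ε`. -/
theorem norm_sub_le_of_trace {V V' : ℂ} {b b' : Fin 4 → ℂ} {ε : ℝ} (σ : Equiv.Perm (Fin 4))
    (hid : ((2 * Real.cos (Real.pi / 12) : ℝ) : ℂ) * V = ∑ k, b k)
    (hid' : ((2 * Real.cos (Real.pi / 12) : ℝ) : ℂ) * V' = ∑ k, b' k)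
    (hb : ∀ k, ‖b k - b' (σ k)‖ ≤ ε * (2 * Real.cos (Real.pi / 12)) / 4) :
    ‖V - V'‖ ≤ ε := by
  have hκ : 0 < 2 * Real.cos (Real.pi / 12) := splitConst_pos
  have hsum : ((2 * Real.cos (Real.pi / 12) : ℝ) : ℂ) * (V - V') = ∑ k, (b k - b' (σ k)) := by
    rw [mul_sub, hid, hid', Finset.sum_sub_distrib, Equiv.sum_comp σ b']
  have h1 : (2 * Real.cos (Real.pi / 12)) * ‖V - V'‖ = ‖∑ k, (b k - b' (σ k))‖ := by
    rw [← hsum, norm_mul, Complex.norm_real, Real.norm_eq_abs, abs_of_pos hκ]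
  have h2 : ‖∑ k, (b k - b' (σ k))‖ ≤ 4 * (ε * (2 * Real.cos (Real.pi / 12)) / 4) :=
    calc ‖∑ k, (b k - b' (σ k))‖
        ≤ ∑ k, ‖b k - b' (σ k)‖ := norm_sum_le _ _
      _ ≤ ∑ _k : Fin 4, ε * (2 * Real.cos (Real.pi / 12)) / 4 := Finset.sum_le_sum fun k _ => hb k
      _ = 4 * (ε * (2 * Real.cos (Real.pi / 12)) / 4) := by simp
  have h3 : (2 * Real.cos (Real.pi / 12)) * ‖V - V'‖ ≤ (2 * Real.cos (Real.pi / 12)) * ε := by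
    rw [h1]
    calc ‖∑ k, (b k - b' (σ k))‖ ≤ 4 * (ε * (2 * Real.cos (Real.pi / 12)) / 4) := h2
      _ = (2 * Real.cos (Real.pi / 12)) * ε := by ring
  exact le_of_mul_le_mul_left h3 hκ

end PrecompactTransfer

open PrecompactTransfer in
/-- **STUB 7 — precompact transfer.** `EdgePrecompact` and the trace identity on compacts give
clause (ii) of the crux (`VertexPrecompactAt D Λ`) for every guarded family: clause (i) with the
constant `4C/(2cos(π/12))` from (i) of `EdgePrecompact` on an inner collar `cthickening ρ K ⊆ D`;
clause (ii) by a same-class pairing of the corners (`exists_partner`), `ε' = ε · 2cos(π/12) / 4`,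
`η = η'/2`, meshes
`δ < min ρ (η'/2)`. -/
theorem stub_precompactTransfer : Sig.stub_precompactTransfer := by
  intro hEP D Λ hG hTI K hK hKD
  obtain ⟨hΩ, hδ, hadm⟩ := hG
  -- an inner collar for `K`: the corner sites of an edge with medial point in `K` lie in `K'`
  obtain ⟨ρ, hρ, hρK⟩ := hK.exists_cthickening_subset_open D.isOpen hKD
  have hK' : IsCompact (cthickening ρ K) := hK.cthickening
  obtain ⟨⟨C, hC⟩, hii⟩ :=
    edgePrecompact_cornerObs hEP D Λ hΩ hδ hadm (cthickening ρ K) hK' hρK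
  have htr : ∀ᶠ δ in 𝓝[>] (0:ℝ), ∀ (x : Site 2) (i : Fin 2),
      medialPoint δ s(x, x + Pi.single i 1) ∈ K →
        ((2 * Real.cos (Real.pi / 12) : ℝ) : ℂ) * vertexObs Λ δ s(x, x + Pi.single i 1) =
          ∑ k : Fin 4, cornerObs Λ δ (cornersAt x i k) := hTI K hK hKD
  -- eventualities in `δ`
  have hpos : ∀ᶠ δ in 𝓝[>] (0:ℝ), 0 < δ := eventually_mem_nhdsWithin
  have hltρ : ∀ᶠ δ in 𝓝[>] (0:ℝ), δ < ρ := (eventually_lt_nhds hρ).filter_mono nhdsWithin_le_nhds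
  refine ⟨⟨4 * C / (2 * Real.cos (Real.pi / 12)), ?_⟩, ?_⟩
  · -- clause (i)
    filter_upwards [hC, htr, hpos, hltρ] with δ hCδ htrδ hδ0 hδρ
    intro z hz hzK
    obtain ⟨x, i, rfl⟩ := exists_eq_mk_add_single hz
    have hk : ∀ k : Fin 4, ‖cornerObs Λ δ (cornersAt x i k)‖ ≤ C * δ ^ ((1:ℝ) / 3) := fun k =>
      hCδ (cornersAt x i k).1 (cornersAt x i k).2 (isCorner_cornersAt x i k)
        (meshPoint_fst_cornersAt_mem_cthickening hδ0.le hδρ.le x i k hzK)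
    have h := norm_le_of_trace (htrδ x i hzK) hk
    calc ‖vertexObs Λ δ s(x, x + Pi.single i 1)‖
        ≤ 4 * (C * δ ^ ((1:ℝ) / 3)) / (2 * Real.cos (Real.pi / 12)) := h
      _ = 4 * C / (2 * Real.cos (Real.pi / 12)) * δ ^ ((1:ℝ) / 3) := by ring
  · -- clause (ii)
    intro ε hε
    have hκ : 0 < 2 * Real.cos (Real.pi / 12) := splitConst_pos
    obtain ⟨η', hη', hev⟩ := hii (ε * (2 * Real.cos (Real.pi / 12)) / 4) (by positivity)
    refine ⟨η' / 2, by positivity, ?_⟩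
    have hltη : ∀ᶠ δ in 𝓝[>] (0:ℝ), δ < η' / 2 :=
      (eventually_lt_nhds (by positivity : (0:ℝ) < η' / 2)).filter_mono nhdsWithin_le_nhds
    filter_upwards [hev, htr, hpos, hltρ, hltη] with δ hevδ htrδ hδ0 hδρ hδη
    intro z z' hz hz' hzK hz'K hdist
    obtain ⟨x, i, rfl⟩ := exists_eq_mk_add_single hz
    obtain ⟨x', i', rfl⟩ := exists_eq_mk_add_single hz'
    obtain ⟨σ, hσ⟩ := exists_partner i i'
    have hk : ∀ k : Fin 4,
        ‖cornerObs Λ δ (cornersAt x i k) - cornerObs Λ δ (cornersAt x' i' (σ k))‖ ≤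
          ε * (2 * Real.cos (Real.pi / 12)) / 4 * δ ^ ((1:ℝ) / 3) := by
      intro k
      refine hevδ (cornersAt x i k).1 (cornersAt x i k).2 (cornersAt x' i' (σ k)).1
        (cornersAt x' i' (σ k)).2 (isCorner_cornersAt x i k) (isCorner_cornersAt x' i' _)
        (hσ x x' k) (meshPoint_fst_cornersAt_mem_cthickening hδ0.le hδρ.le x i k hzK)
        (meshPoint_fst_cornersAt_mem_cthickening hδ0.le hδρ.le x' i' _ hz'K) ?_
      calc dist (meshPoint δ (cornersAt x i k).1) (meshPoint δ (cornersAt x' i' (σ k)).1)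
          ≤ dist (medialPoint δ s(x, x + Pi.single i 1)) (medialPoint δ s(x', x' + Pi.single i' 1))
              + δ := dist_fst_cornersAt_le hδ0.le x x' i i' k _
        _ < η' := by linarith
    have hk' : ∀ k : Fin 4,
        ‖cornerObs Λ δ (cornersAt x i k) - cornerObs Λ δ (cornersAt x' i' (σ k))‖ ≤
          ε * δ ^ ((1:ℝ) / 3) * (2 * Real.cos (Real.pi / 12)) / 4 := fun k =>
      (hk k).trans_eq (by ring)
    exact norm_sub_le_of_trace σ (htrδ x i hzK) (htrδ x' i' hz'K) hk'

end

end Summit.CriticalPhenomena.CardyFormulaZ2.Cruxes.CoherentMorera.FinitaryGreenPairing
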